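import Summits.QuantumFields.BalabanUV.Beta.MultiscaleCombesThomasL2CellsGraded

/-!
# `Summit.QuantumFields.BalabanUV.Beta.MultiscaleSupMemberBall` — engine file 9a: the ℓ²-LOCALIZED bound for the multi-region
# averaged MODEL operator `levelOp` on a scale-adapted BALL `{q : d_n(q,x₀) ≤ ρ₀}` around an arbitrary evaluation site, with the
# profile floor from the sitewise ADDITIVE grading; cell cardinalities and the sup → ℓ² step on the source cell (the inputs of
# file 9b `MultiscaleSupMember`, the sup-norm member (3.42)₁'s SHAPE from a typed local-regularity datum)

HONEST FRAMING (page 1 of everything in this cell).  Discharging `FlowStep.BetaPertH` would make Bałaban's ultraviolet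
stability UNCONDITIONAL — a constructive-QFT result; it is NOT the continuum limit and NOT the Clay problem.  This module
discharges nothing of `BetaPertH`; it is [folklore] finite-dimensional bookkeeping, kernel-checked, by the OWNER of binder row D4
(unit `b2b-balaban-beta-an4`, gen 44).  HONEST DEPENDENCY: continuum YM on T⁴ ⇐ BetaPertH ∧ nine spine estimates (0/9 proved);
BetaPertH ⇐ (D1) ∧ (D4) ∧ CAP+tail; G-an2-4 gates asym, D1 and NE2/3/4.

WHAT IS CERTIFIED (kernel, 0 sorry), in the analytic setting of `MultiscaleDecay.hc_levelOp` (pv21's `levelOp` on the torus `UT N`,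
isometric bond matrices and level transports, a pairwise-disjoint COVERING cube family — cell `k`: level `l_k`, side `S_{l_k}`, corner
`t_k = ctrU (zc k)` —, print-size weights from above, `|c| ≤ c_max`, cell-sum coercivity `C`, rate `0 ≤ κ ≤ 1`,
`μ₀ = C − 2d·c_max²κ² − a_max(e^{2dκ} − 1) > 0`; `n(x)` the site scale, `d_n` (K)'s scale-adapted distance):
* §1 (generic bond structure) `scale_pow_le` — graded scales `n = L^e` and the additive datum `|e(x) − e(y)| ≤ A + d_n(x,y)/R` give
  `n(y)^d ≤ (L^A·e^{(log L/R)d_n(x,y)}·n(x))^d` (beta-d4-p2's `scale_le_scale_mul_exp_add` to the `d`-th power); `sqrt_mul_pow`;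
* §2 `card_cell_le` (`#cell k ≤ S_{l_k}^d`, the cell is the image of the cube chart), `card_cellCp_le`, **`cell_norm_le_of_abs_le`**
  (`|u| ≤ m` ⟹ `√(Σ_{cell k′ × Cp}u²) ≤ √(S_{l_{k′}}^d·|Cp|)·m` — the sup → ℓ² step on the SOURCE cell; this is where `√#Δ(y′)` enters);
* §3 **`real_ballNorm_levelOp_inverse_le`** — graded level sides `S_l = L^{e_l}` (`1 ≤ L`, `0 < R`) with the SITEWISE additive datum,
  `u` supported in cell `k′`, any site `x₀`, any radius `ρ₀`:
  `√(Σ_{d_n(q,x₀) ≤ ρ₀}((levelOp)⁻¹u)(q)²) ≤ e^{−κ(d_n(x₀,t_{k′}) − ρ₀ − 2d)}/√((μ₀(Γn(x₀))⁻²)(μ₀S_{l_{k′}}⁻²))·√(Σ_{cell k′}u²)`,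
  `Γ = L^A e^{(log L/R)ρ₀}` — file 6 `real_set_norm_inverse_le` with the weight `κ·d_n(·,t_{k′})` (`hc_levelOp` at the base point
  `t_{k′}`), target set = the ball (floor `d_n(x₀,t_{k′}) − ρ₀` by beta-d4-p2's `sdist_triangle_torus` + `sdist_comm`; profile floor
  `μ₀(Γn(x₀))⁻²` by the additive datum), source set = cell `k′` (oscillation `2d` by K4's `sdist_corner_thresholds`).
Ingredients BY NAME, nothing restated (file 6 p232270; beta-d4-p2 p230877, p232539, p232829; beta-d4-p3 K4 p232018; file 8 p234033).

LOCATORS (shape only, nothing printed asserted; ABSOLUTE RULE): [Balaban1985BackgroundPropagators] Thm 3.1 (3.42) p. 397, (3.46)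
p. 398; [Balaban1984PropagatorsII] (2.1)–(2.2) p. 224, (2.46) p. 231.  Row D4: NO class change (critical-path width 0; D4 DISCHARGE
NO DATE); NOT BetaPertH, NOT continuum, NOT Clay, NOT summit progress.
-/

open scoped BigOperators
open Finset

namespace Summit.QuantumFields.BalabanUV.Beta.MultiscaleSupMemberBall

open Summit.QuantumFields.BalabanUV.Beta.MultiscaleCombesThomasL2Real (real_set_norm_inverse_le)
open Summit.QuantumFields.BalabanUV.Beta.MultiscaleCombesThomasL2CellsGraded (siteScale_ctrU)
open Summit.QuantumFields.BalabanUV.Beta.BoxPoincare (Box)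
open Summit.QuantumFields.BalabanUV.Beta.MultiscaleCoerciveTorus
open Summit.QuantumFields.BalabanUV.Beta.MultiscaleDistance
open Summit.QuantumFields.BalabanUV.Beta.MultiscaleDistanceGraded (scale_le_scale_mul_exp_add)
open Summit.QuantumFields.BalabanUV.Beta.MultiscaleDistanceMetric (sdist_comm sdist_triangle_torus)
open Summit.QuantumFields.BalabanUV.Beta.MultiscaleDecayBudget
open Summit.QuantumFields.BalabanUV.Beta.MultiscaleDecay (hc_levelOp decay_levelOp)
open Summit.QuantumFields.BalabanUV.Beta.AccretiveCombesThomasSandwichSite (sdist_corner_thresholds)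
open Literature.MathematicalPhysics.QuantumFieldTheory.Balaban1983to89
open Literature.MathematicalPhysics.QuantumFieldTheory.Balaban1983to89.B9Thm37GluePU (bsrc btgt)
open Literature.MathematicalPhysics.QuantumFieldTheory.Balaban1983to89.B9Thm37GlueTorusCov (tblk)
open Literature.MathematicalPhysics.QuantumFieldTheory.Balaban1983to89.B9Thm37GlueTorusCovLevels (levelOp)
open B5TorusCover (UT Ctr ctrU)

noncomputable section

/-! ## §1 Generic: graded exchange of the volume ratio and square-root bookkeeping -/

section Generic

variable {St Bd : Type} (src tgt : Bd → St) (n : St → ℕ)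

/-- **Graded exchange of the `d`-th powers** (natural power, no `rpow`): `n = L^e`, `1 ≤ L`, the additive datum at `(x,y)` ⟹
`n(y)^d ≤ (L^A·e^{(log L/R)·d_n(x,y)}·n(x))^d`. [folklore] -/
theorem scale_pow_le {L : ℕ} (hL : 1 ≤ L) (e : St → ℕ) (hn : ∀ x, n x = L ^ e x) {R : ℝ} {A : ℕ} (d : ℕ)
    {x y : St} (hadd : |(e x : ℝ) - e y| ≤ A + sdist src tgt n x y / R) :
    ((n y : ℝ)) ^ d ≤ ((L : ℝ) ^ A * Real.exp (Real.log L / R * sdist src tgt n x y) * n x) ^ d := by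
  have h := scale_le_scale_mul_exp_add src tgt n hL e hn (A := A) hadd
  have h' : (n y : ℝ) ≤ (L : ℝ) ^ A * Real.exp (Real.log L / R * sdist src tgt n x y) * n x := by
    calc (n y : ℝ) ≤ (L : ℝ) ^ A * n x * Real.exp (Real.log L / R * sdist src tgt n x y) := h
      _ = (L : ℝ) ^ A * Real.exp (Real.log L / R * sdist src tgt n x y) * n x := by ring
  exact pow_le_pow_left₀ (Nat.cast_nonneg _) h' d

end Generic

/-- `√((a·b)^d) = √(a^d)·√(b^d)` for `a, b ≥ 0`. [folklore] -/
theorem sqrt_mul_pow {a b : ℝ} (ha : 0 ≤ a) (d : ℕ) :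
    Real.sqrt ((a * b) ^ d) = Real.sqrt (a ^ d) * Real.sqrt (b ^ d) := by
  rw [mul_pow, Real.sqrt_mul (pow_nonneg ha d)]

variable {d : ℕ} {N : Fin d → ℕ} [∀ i, NeZero (N i)] [NeZero d] {Cp J K : Type} [Fintype Cp] [DecidableEq Cp] [Nonempty Cp]
  [Fintype J] [Fintype K] [DecidableEq K] (S : J → ℕ) (hS : ∀ l, 1 ≤ S l) (hdivS : ∀ l i, S l ∣ N i) (lvl : K → J)
  (zc : (k : K) → Ctr N (S (lvl k)))

/-! ## §2 Cells: cardinality and the sup → ℓ² step on the source cell -/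

omit [NeZero d] [Fintype Cp] [DecidableEq Cp] [Nonempty Cp] [Fintype J] [Fintype K] in
/-- A cell of level `l_k` has at most `S_{l_k}^d` sites (it is the image of the cube chart). [folklore] -/
theorem card_cell_le (hcover : ∀ x : UT N, ∃ k, ∃ v : Box d (S (lvl k)), cellPt S hS hdivS lvl zc k v = x) (k : K) :
    (univ.filter (fun x : UT N => cellOf S hS hdivS lvl zc hcover x = k)).card ≤ S (lvl k) ^ d := by
  classical
  have hsub : (univ.filter (fun x : UT N => cellOf S hS hdivS lvl zc hcover x = k)) ⊆
      Finset.univ.image (cellPt S hS hdivS lvl zc k) := by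
    intro x hx
    have hk := (mem_filter.mp hx).2
    obtain ⟨v, hv⟩ := cellOf_spec S hS hdivS lvl zc hcover x
    subst hk
    exact Finset.mem_image.mpr ⟨v, mem_univ _, hv⟩
  calc (univ.filter (fun x : UT N => cellOf S hS hdivS lvl zc hcover x = k)).card
      ≤ (Finset.univ.image (cellPt S hS hdivS lvl zc k)).card := Finset.card_le_card hsub
    _ ≤ (Finset.univ : Finset (Box d (S (lvl k)))).card := Finset.card_image_le
    _ = S (lvl k) ^ d := by simp [Box]

omit [NeZero d] [DecidableEq Cp] [Nonempty Cp] [Fintype J] [Fintype K] in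
/-- `#(cell k × Cp) ≤ S_{l_k}^d·|Cp|`. [folklore] -/
theorem card_cellCp_le (hcover : ∀ x : UT N, ∃ k, ∃ v : Box d (S (lvl k)), cellPt S hS hdivS lvl zc k v = x) (k : K) :
    (univ.filter (fun p : UT N × Cp => cellOf S hS hdivS lvl zc hcover p.1 = k)).card ≤ S (lvl k) ^ d * Fintype.card Cp := by
  classical
  have heq : (univ.filter (fun p : UT N × Cp => cellOf S hS hdivS lvl zc hcover p.1 = k)) =
      (univ.filter (fun x : UT N => cellOf S hS hdivS lvl zc hcover x = k)) ×ˢ (univ : Finset Cp) := by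
    ext p
    simp only [mem_filter, mem_univ, true_and, mem_product, and_true]
  rw [heq, Finset.card_product, Finset.card_univ]
  exact Nat.mul_le_mul_right _ (card_cell_le S hS hdivS lvl zc hcover k)

omit [NeZero d] [DecidableEq Cp] [Nonempty Cp] [Fintype J] [Fintype K] in
/-- **sup → ℓ² on the source cell**: `|u| ≤ m` ⟹ `√(Σ_{cell k′ × Cp} u²) ≤ √(S_{l_{k′}}^d·|Cp|)·m`. [folklore] -/
theorem cell_norm_le_of_abs_le (hcover : ∀ x : UT N, ∃ k, ∃ v : Box d (S (lvl k)), cellPt S hS hdivS lvl zc k v = x) (k' : K)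
    (u : UT N × Cp → ℝ) {m : ℝ} (hm : 0 ≤ m) (hum : ∀ p, |u p| ≤ m) :
    Real.sqrt (∑ p ∈ univ.filter (fun p : UT N × Cp => cellOf S hS hdivS lvl zc hcover p.1 = k'), u p ^ 2) ≤
      Real.sqrt ((S (lvl k') : ℝ) ^ d * Fintype.card Cp) * m := by
  classical
  set F := univ.filter (fun p : UT N × Cp => cellOf S hS hdivS lvl zc hcover p.1 = k') with hF
  have hsum : ∑ p ∈ F, u p ^ 2 ≤ (F.card : ℝ) * m ^ 2 := by
    calc ∑ p ∈ F, u p ^ 2 ≤ ∑ p ∈ F, m ^ 2 := Finset.sum_le_sum fun p _ => by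
            have := hum p
            rw [← sq_abs]
            exact pow_le_pow_left₀ (abs_nonneg _) this 2
      _ = (F.card : ℝ) * m ^ 2 := by rw [Finset.sum_const, nsmul_eq_mul]
  have hcard : (F.card : ℝ) ≤ (S (lvl k') : ℝ) ^ d * Fintype.card Cp := by
    exact_mod_cast card_cellCp_le S hS hdivS lvl zc hcover k'
  calc Real.sqrt (∑ p ∈ F, u p ^ 2) ≤ Real.sqrt ((S (lvl k') : ℝ) ^ d * Fintype.card Cp * m ^ 2) :=
        Real.sqrt_le_sqrt (hsum.trans (mul_le_mul_of_nonneg_right hcard (sq_nonneg m)))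
    _ = Real.sqrt ((S (lvl k') : ℝ) ^ d * Fintype.card Cp) * m := by
        rw [Real.sqrt_mul (by positivity), Real.sqrt_sq hm]

/-! ## The analytic setting of `MultiscaleDecay.hc_levelOp`, as section variables (as in files 7∕8 and K4 §6) -/

variable
    (hdisj : ∀ k k' v v', cellPt S hS hdivS lvl zc k v = cellPt S hS hdivS lvl zc k' v' → k = k')
    (hcover : ∀ x : UT N, ∃ k, ∃ v : Box d (S (lvl k)), cellPt S hS hdivS lvl zc k v = x)
    (Rm : UT N × Fin d → Cp → Cp → ℝ) (hRm : ∀ b i j, ∑ k, Rm b k i * Rm b k j = if i = j then (1 : ℝ) else 0)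
    (T : J → UT N → Cp → Cp → ℝ) (hT : ∀ l x i i', ∑ k, T l x k i * T l x k i' = if i = i' then (1 : ℝ) else 0)
    (a : J → ℝ) (ha : ∀ j, 0 ≤ a j) (ω : J → UT N → ℝ)
    (hsupp : ∀ l x, ω l (ctrU N (S l) (tblk (hS l) (hdivS l) x)) ≠ 0 → ∃ k v, lvl k = l ∧ cellPt S hS hdivS lvl zc k v = x)
    {amax : ℝ} (hamax : 0 ≤ amax)
    (hscale : ∀ k, a (lvl k) * ω (lvl k) (ctrU N (S (lvl k)) (zc k)) ^ 2 * (S (lvl k) : ℝ) ^ d ≤ amax / (S (lvl k) : ℝ) ^ 2)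
    (c : UT N × Fin d → ℝ) {cmax : ℝ} (hc : ∀ b, |c b| ≤ cmax) {C : ℝ}
    (hcoer : ∀ f : UT N × Cp → ℝ,
      C * ∑ k, ((S (lvl k) : ℝ) ^ 2)⁻¹ * ∑ v : Box d (S (lvl k)), ∑ i, f (cellPt S hS hdivS lvl zc k v, i) ^ 2 ≤
        ∑ p, f p * levelOp bsrc btgt c Rm (fun l x => ctrU N (S l) (tblk (hS l) (hdivS l) x))
          (fun l x => ω l (ctrU N (S l) (tblk (hS l) (hdivS l) x))) T a f p)
    {κ : ℝ} (hκ0 : 0 ≤ κ) (hκ1 : κ ≤ 1)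

include hdisj hRm hT ha hsupp hamax hscale hc hcoer hκ0 hκ1

/-! ## §3 File 6 on a scale-adapted BALL around the evaluation site -/

/-- **THE ℓ²-LOCALIZED BOUND ON A `d_n`-BALL.**  Graded level sides `S_l = L^{e_l}` (`1 ≤ L`, `0 < R`) with the SITEWISE additive
datum `|e(x) − e(y)| ≤ A + d_n(x,y)/R` (`e(x) := e_{l_{cellOf x}}`); `u` supported in cell `k′`; a site `x₀` and a radius `ρ₀`.
Then `√(Σ_{q : d_n(q,x₀) ≤ ρ₀}((levelOp)⁻¹u)(q)²) ≤
e^{−κ(d_n(x₀,t_{k′}) − ρ₀ − 2d)} / √((μ₀(L^A e^{(log L/R)ρ₀} n(x₀))⁻²)(μ₀S_{l_{k′}}⁻²)) · √(Σ_{cell k′}u²)` — file 6's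
`real_set_norm_inverse_le` with the weight `κ·d_n(·,t_{k′})` (`hc_levelOp` at the base point `t_{k′}`), target set = the ball
(floor `d_n(x₀,t_{k′}) − ρ₀` by the triangle inequality, profile floor `μ₀(Γn(x₀))⁻²`, `Γ = L^A e^{(log L/R)ρ₀}`, by the additive
datum), source set = cell `k′` (oscillation `2d`, profile `μ₀S_{l_{k′}}⁻²`).
[cite: Balaban1985BackgroundPropagators, Thm 3.1 (3.46) p.398; Balaban1984PropagatorsII, (2.46) p.231] [folklore] -/
theorem real_ballNorm_levelOp_inverse_le (hμ : 0 < C - 2 * d * cmax ^ 2 * κ ^ 2 - amax * (Real.exp (2 * d * κ) - 1))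
    {L : ℕ} (hL : 1 ≤ L) (e : J → ℕ) (hSe : ∀ l, S l = L ^ e l) {R : ℝ} (hR : 0 < R) {A : ℕ}
    (hadd : ∀ x y : UT N, |(e (lvl (cellOf S hS hdivS lvl zc hcover x)) : ℝ) - e (lvl (cellOf S hS hdivS lvl zc hcover y))| ≤
      A + sdist bsrc btgt (siteScale S hS hdivS lvl zc hcover) x y / R)
    (k' : K) (u : UT N × Cp → ℝ) (hu : ∀ p, cellOf S hS hdivS lvl zc hcover p.1 ≠ k' → u p = 0)
    (x₀ : UT N) (ρ₀ : ℝ) :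
    Real.sqrt (∑ q ∈ univ.filter (fun q : UT N × Cp =>
        sdist bsrc btgt (siteScale S hS hdivS lvl zc hcover) q.1 x₀ ≤ ρ₀),
        (Ring.inverse (levelOp bsrc btgt c Rm (fun l x => ctrU N (S l) (tblk (hS l) (hdivS l) x))
          (fun l x => ω l (ctrU N (S l) (tblk (hS l) (hdivS l) x))) T a)) u q ^ 2) ≤
      Real.exp (-(κ * ((sdist bsrc btgt (siteScale S hS hdivS lvl zc hcover) x₀ (ctrU N (S (lvl k')) (zc k')) - ρ₀) - 2 * d))) /
        Real.sqrt ((C - 2 * d * cmax ^ 2 * κ ^ 2 - amax * (Real.exp (2 * d * κ) - 1)) *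
            (((L : ℝ) ^ A * Real.exp (Real.log L / R * ρ₀) * (siteScale S hS hdivS lvl zc hcover x₀ : ℝ)) ^ 2)⁻¹ *
          ((C - 2 * d * cmax ^ 2 * κ ^ 2 - amax * (Real.exp (2 * d * κ) - 1)) * ((S (lvl k') : ℝ) ^ 2)⁻¹)) *
        Real.sqrt (∑ q ∈ univ.filter (fun q : UT N × Cp => cellOf S hS hdivS lvl zc hcover q.1 = k'), u q ^ 2) := by
  classical
  obtain ⟨i₀⟩ := ‹Nonempty Cp›
  set μ₀ := C - 2 * d * cmax ^ 2 * κ ^ 2 - amax * (Real.exp (2 * d * κ) - 1) with hμ₀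
  set Aop := levelOp bsrc btgt c Rm (fun l x => ctrU N (S l) (tblk (hS l) (hdivS l) x))
    (fun l x => ω l (ctrU N (S l) (tblk (hS l) (hdivS l) x))) T a with hAop
  set n := siteScale S hS hdivS lvl zc hcover with hn
  set tk' : UT N := ctrU N (S (lvl k')) (zc k') with htk'
  set Γ : ℝ := (L : ℝ) ^ A * Real.exp (Real.log L / R * ρ₀) with hΓ
  have hL0 : (0 : ℝ) < L := by exact_mod_cast hL
  have hΓpos : 0 < Γ := mul_pos (pow_pos hL0 A) (Real.exp_pos _)
  have hunit : IsUnit Aop :=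
    (decay_levelOp S hS hdivS lvl zc hdisj hcover Rm hRm T hT a ha ω hsupp hamax hscale c hc hcoer hκ0 hκ1 hμ
      (tk', i₀) (tk', i₀)).1
  have hSpos : ∀ l, (0 : ℝ) < (S l : ℝ) := fun l => by exact_mod_cast hS l
  have hnpos : ∀ x, (0 : ℝ) < (n x : ℝ) := fun x => by exact_mod_cast one_le_siteScale S hS hdivS lvl zc hcover x
  have hμpos : ∀ p : UT N × Cp, 0 < μ₀ * ((n p.1 : ℝ) ^ 2)⁻¹ := fun p =>
    mul_pos hμ (inv_pos.mpr (pow_pos (hnpos p.1) 2))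
  have hcH : ∀ v : UT N × Cp → ℝ, ∑ p, μ₀ * ((n p.1 : ℝ) ^ 2)⁻¹ * v p ^ 2 ≤
      ∑ p, Real.exp (κ * sdist bsrc btgt n p.1 tk') * v p * Aop (fun q => Real.exp (-(κ * sdist bsrc btgt n q.1 tk')) * v q) p :=
    fun v => hc_levelOp S hS hdivS lvl zc hdisj hcover Rm hRm T hT a ha ω hsupp hamax hscale c hc hcoer hκ0 hκ1 (tk', i₀) v
  have hthr := sdist_corner_thresholds S hS hdivS lvl zc hdisj hcover
  -- the grading of the site scale
  have hgr : ∀ x, n x = L ^ (e (lvl (cellOf S hS hdivS lvl zc hcover x))) := fun x => by rw [hn, siteScale, hSe]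
  have ht0 : 0 ≤ Real.log L / R := div_nonneg (Real.log_nonneg (by exact_mod_cast hL)) hR.le
  refine real_set_norm_inverse_le hunit hμpos hκ0 hcH
    (univ.filter (fun q : UT N × Cp => sdist bsrc btgt n q.1 x₀ ≤ ρ₀))
    (univ.filter (fun q : UT N × Cp => cellOf S hS hdivS lvl zc hcover q.1 = k'))
    (fun p hp => hu p (fun h => hp (mem_filter.mpr ⟨mem_univ _, h⟩)))
    (mul_pos hμ (inv_pos.mpr (pow_pos (mul_pos hΓpos (hnpos x₀)) 2)))
    (mul_pos hμ (inv_pos.mpr (pow_pos (hSpos (lvl k')) 2)))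
    (fun q hq => ?_) (fun q hq => ?_) (fun q hq => ?_) (fun q hq => ?_)
  · -- target floor on the ball: `d_n(x₀,t_{k′}) − ρ₀ ≤ d_n(q,t_{k′})` by the triangle inequality and symmetry
    have hq' : sdist bsrc btgt n q.1 x₀ ≤ ρ₀ := (mem_filter.mp hq).2
    have htri := sdist_triangle_torus n x₀ q.1 tk'
    have hsym : sdist bsrc btgt n x₀ q.1 = sdist bsrc btgt n q.1 x₀ := sdist_comm bsrc btgt n x₀ q.1
    linarith
  · -- source oscillation on cell `k′`
    exact (hthr q.1 k').1 (mem_filter.mp hq).2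
  · -- profile floor on the ball: `n(q) ≤ Γ·n(x₀)`
    have hq' : sdist bsrc btgt n q.1 x₀ ≤ ρ₀ := (mem_filter.mp hq).2
    have hsym : sdist bsrc btgt n x₀ q.1 = sdist bsrc btgt n q.1 x₀ := sdist_comm bsrc btgt n x₀ q.1
    have hsc := scale_le_scale_mul_exp_add bsrc btgt n hL (fun x => e (lvl (cellOf S hS hdivS lvl zc hcover x))) hgr
      (A := A) (hadd x₀ q.1)
    have hle : (n q.1 : ℝ) ≤ Γ * n x₀ := by
      calc (n q.1 : ℝ) ≤ (L : ℝ) ^ A * n x₀ * Real.exp (Real.log L / R * sdist bsrc btgt n x₀ q.1) := hsc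
        _ ≤ (L : ℝ) ^ A * n x₀ * Real.exp (Real.log L / R * ρ₀) := by
            refine mul_le_mul_of_nonneg_left (Real.exp_le_exp.mpr ?_) (by positivity)
            rw [hsym]; exact mul_le_mul_of_nonneg_left hq' ht0
        _ = Γ * n x₀ := by rw [hΓ]; ring
    have hq0 : (0 : ℝ) < n q.1 := hnpos q.1
    refine mul_le_mul_of_nonneg_left ?_ hμ.le
    rw [inv_le_inv₀ (pow_pos (mul_pos hΓpos (hnpos x₀)) 2) (pow_pos hq0 2)]
    exact pow_le_pow_left₀ hq0.le hle 2
  · have hpk : cellOf S hS hdivS lvl zc hcover q.1 = k' := (mem_filter.mp hq).2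
    have hnq : n q.1 = S (lvl k') := by rw [hn, siteScale, hpk]
    rw [hnq]

end

end Summit.QuantumFields.BalabanUV.Beta.MultiscaleSupMemberBall
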